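import Mathlib
import Literature.MathematicalPhysics.QuantumFieldTheory.Balaban1983to89.B11MeanValue190
import Literature.MathematicalPhysics.QuantumFieldTheory.Balaban1983to89.B11Eq183Differentiation

/-!
# `Balaban1983to89.B11Presentation190` — [Balaban1985Variational] Prop. 9 (190) p. 308 «… for x ∈ Δ(y) …»: LATTICE PRESENTATIONS of
# the configuration space of (115), the transport of the decay bound (190) from the Banach-space derivative `(δ/δB)𝓗` to the lattice
# sizes of the consumers, and the mean-value domination `hmv` for the chart in BOTH printed representations (174)–(175) / (179)–(180)
# — the bridge between the B11 block's (190) for the actual Fréchet derivative (`B11SectG.ineq190_of_189`,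
# `B11Eq183Differentiation`) and the «(190)-knits» of [Balaban1989LargeFieldI] §1 / [Balaban1988Convergent] §3

statement-level skeleton of published theorems with citation tags; proofs where landed; nothing here is a claim about
the Yang–Mills mass gap.

CITATION HEADER (lean-in-tree rule 2026-08-18).  T. Bałaban, *The variational problem and background fields in renormalization group
method for lattice gauge theories*, Commun. Math. Phys. **102**, 277–309 (1985), doi:10.1007/BF01229381, bib `Balaban1985Variational`
(cell paper B11; Prop. 9 p. 309, (190) p. 308, (174)–(180) pp. 305–306, (182)–(188) pp. 307–308, (115) p. 294 = PDF 18 l. 34, the last display of that page — citeloc docfix of this version, r08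
g13's sweep, re-read by this seat).  PDF held:
`paper:balaban1985-cmp102-variational-background` (journal page = PDF page + 276); displays as transcribed and render-verified in
`B11SectG` / `B11Eq174Chart` / `B11Eq183Differentiation`.  Consumers: [Balaban1989LargeFieldI] CMP **122** §1 (B15), [Balaban1988Convergent]
CMP **119** §3 (B14).

WHAT IS REPRODUCED — SKELETON rows B11.Eq190 / B11.Prop9 / B11.Eq182 (owner r08), the B15 (190)-knit rows (r12) and the B14 (190)-knit
rows (r11); GAPS G-B15-r12-08 Addendum 3 items (a) («(190) between the concrete sizes») and (e′) («differentiability of the concrete ℍ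
along the segment»), G-B14-08.  THE PRINT, (190) p. 308 (verbatim as quoted in `B11SectG`): *«|(δ/δB_ν(y′))𝓗_μ(B,x)|,
|∇_x(δ/δB_ν(y′))𝓗_μ(B,x)|, … ≤ O(1)[(L^jη)^{−1}, (L^jη)^{−2}, …]·(L^{j′}η)^{−d} exp(−⅛δ₀d(y,y′)) (190) for x ∈ Δ(y), or supp ζ ⊂ Δ̃(y),
y ∈ Λ_j, y′ ∈ Λ_{j′}.»*  The B11 block proves (190) as a MAJORANT statement `Ineq190 bB bN dH C δ₀` for the actual derivative
`dH = (δ/δB)𝓗 = fderiv ℂ (chartH179 …) B` between block sizes `bB` on the `B`-space `𝒳` and `bN` on the configuration space `𝒴` of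
(115) (`B11SectG.ineq190_of_189` from (182), (184), (188), (189), Lemma 2.1; `B11Eq183Differentiation.eq182_sectG`/`eq184_sectG`/
`bound188_sectG` instantiate its carriers with the actual derivatives).  The consumers read the left-hand sides of (190) as sizes of
LATTICE FUNCTIONS `x ↦ 𝓗_μ(B, x)` — r11's `B11SupSize190.supSize g box blk` («for x ∈ Δ(y)») and `B11SeminormSize190.covDerivBlockSize`
— and need, per argument field `B`, the PAIR of located hypotheses `h190 : ∀ t, Ineq190 bB bout (dH t) C δ₀` and
`hmv : ∀ s, (∀ t, bout.loc y (dH t B) ≤ s) → bout.loc y (ℍ B) ≤ s` (`B15HDecayLeaves.loc_le_of_meanValue` and every knit).  A lattice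
PRESENTATION of `𝒴` — a family of real CLMs `ev x : 𝒴 →L[ℝ] E` reading off the component vector at the point `x` (on the finite lattice
`T_η` every coordinate functional of the space (115) is one) — turns the former into the latter.  Unit `lit-balaban-p29` gen 9 (Phase-2
free target, G.5-34(d)), HOME `run/shared/lean/pub/lit-balaban/`; sibling of `B11MeanValue190Chart` (the (174)–(175) chart `chartHB`).

WHAT THIS FILE PROVES (kernel-checked, zero `sorry`, theorems only — no definition, no named fact; axioms standard; everything BY NAME).
§1 **`hasMaj_postcomp_of_loc_le`**, **`ineq190_postcomp_of_loc_le`** — TRANSPORT: a majorant / the bound (190) for `T : F₁ → F₂` passes to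
   `P ∘ T` for every linear `P : F₂ → F₃` that does not increase the local sizes (`b₃.loc y (P v) ≤ b₂.loc y v`); same kernel, same
   constants, no row sum.
§2 **`supSize_loc_pi_le`** — COMPATIBILITY of the sup presentation: if the values at the points of the block are dominated by the
   `𝒴`-size (`x ∈ box y → ‖ev x v‖ ≤ bN.loc y v`, print's (115) being a weighted sup norm), then
   `(supSize g box blk).loc y (x ↦ ev x v) ≤ bN.loc y v`.
§3 **`presentation_hyps_of_differentiableAt`** + **`hmv_supSize_of_differentiableAt`** / **`hmv_covDerivBlockSize_of_differentiableAt`** /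
   **`hmv_ofSeminorms_smul_covDerivSize_of_differentiableAt`** — for ANY `Φ : 𝒳 → 𝒴` with `Φ 0 = 0`, ℂ-differentiable at the points `tB`,
   `t ∈ [0,1]`, ANY presentation `H B′ x = ev x (Φ B′)` and ANY derivative family with `(dH t B)(x) = ev x (DΦ(tB)·B)`: the consumers'
   `hmv` at the three sizes of record (gen-8 `B11MeanValue190` + the chain rule along the ray).
§4 THE (179)–(180) REPRESENTATION (r08's `B11Eq183Differentiation.chartH179 𝒢 W D2 H₀ Tm ε₄`, domain `‖H₀B‖ < a ∧ ‖Δ⁽²⁾H₀B‖ < j`):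
   `chartH179_zero`, `dom180_smul` (the segment stays in the domain), `differentiableAt_chartH179_smul` (from r08's
   `analyticOnNhd_chartH179`), and **`hmv_supSize_chartH179`** / **`hmv_covDerivBlockSize_chartH179`** /
   **`hmv_ofSeminorms_smul_covDerivSize_chartH179`** — the (179) twins of `B11MeanValue190Chart`'s (174) theorems.
§5 **`ineq190_and_hmv_supSize_chartH179`** — END TO END for the sup size: from (190) ON `𝒴` for the actual derivatives `D𝓗(B′)` at the
   points `B′` of the domain (the B11 block's output shape) and the compatibility letter of §2, the consumers' PAIR
   `(∀ t, Ineq190 bB (supSize g box blk) (dH t) C δ₀) ∧ (∀ s, (∀ t, loc y (dH t B) ≤ s) → loc y (H B) ≤ s)` for the presented chart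
   `H B′ x = ev x (𝓗(B′))` and `dH t = P ∘ D𝓗(tB)`; **`ineq190_presentation_chartH179`** — the `h190` half alone for ANY output size `b₃`
   on the lattice functions compatible with `bN` (e.g. the first-order sizes, whose `hmv` half is §4).
HONEST SCOPE.  Hypotheses left, exactly: the regime (117)–(121) (`B11Eq174Chart.Regime`), the analyticity letters of Prop. 4 / Sect. C
(`AnalyticOnNhd ℂ W {‖Y‖ < a₃}`, `AnalyticOnNhd ℂ Tm {‖Y‖ < ε₄ + a}` — r08's shapes), `Tm 0 = 0` ((47) with D(0) = 0, (56)), the domain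
condition on `B`, the compatibility letter between the `𝒴`-size `bN` and the point values, and (190) ITSELF on `𝒴` — which the B11 block
derives (`B11SectG.ineq190_of_189`) from (189), the G̃/H₀/H/𝔇 majorants, (2.61) and the located smallness `qG < 1` (rows B11.Eq189/
Eq190, GAPS G-B11-G2).  No lattice object is constructed; the instantiation of `𝒴` as the space (115) on `T_η` with its coordinate
functionals is the presentation datum `ev`.  NOT summit progress.
-/

namespace Literature.MathematicalPhysics.QuantumFieldTheory.Balaban1983to89.B11Presentation190

open Literature.MathematicalPhysics.QuantumFieldTheory.Balaban1983to89
open B11SectG B11SupSize190 B11SeminormSize190 B11Eq174Chart B11Eq183Differentiation B11MeanValue190 Set Metric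
open scoped NNReal

/-! ## §1. Transport of majorants / of (190) along a size-nonincreasing linear presentation -/

section Transport

variable {g : B6.Geometry} {F₁ F₂ F₃ : Type} [AddCommGroup F₁] [Module ℝ F₁] [AddCommGroup F₂] [Module ℝ F₂]
  [AddCommGroup F₃] [Module ℝ F₃]

/-- **Transport of a majorant**: if `T` has the majorant `K` from `b₁` to `b₂` and the linear presentation `P : F₂ → F₃` does not increase
the local sizes (`b₃.loc y (P v) ≤ b₂.loc y v`), then `P ∘ T` has the SAME majorant from `b₁` to `b₃`.
[cite: Balaban1985Variational, (190) p.308] -/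
theorem hasMaj_postcomp_of_loc_le {b₁ : BlockNorm g F₁} {b₂ : BlockNorm g F₂} {b₃ : BlockNorm g F₃} {T : F₁ →ₗ[ℝ] F₂}
    {K : g.Site → g.Site → ℝ} (P : F₂ →ₗ[ℝ] F₃) (hP : ∀ (y : g.Site) (v : F₂), b₃.loc y (P v) ≤ b₂.loc y v)
    (h : HasMaj b₁ b₂ T K) : HasMaj b₁ b₃ (P ∘ₗ T) K :=
  fun y' μ hμ y => (hP y (T μ)).trans (h y' μ hμ y)

/-- **Transport of (190)**: `Ineq190 bB bN dH C δ₀` on the configuration space and a size-nonincreasing presentation `P` give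
`Ineq190 bB b₃ (P ∘ dH) C δ₀` on the presented space — same `C`, same `δ₀`. [cite: Balaban1985Variational, (190) p.308] -/
theorem ineq190_postcomp_of_loc_le {bB : BlockNorm g F₁} {bN : BlockNorm g F₂} {b₃ : BlockNorm g F₃} {dH : F₁ →ₗ[ℝ] F₂}
    {C δ₀ : ℝ} (P : F₂ →ₗ[ℝ] F₃) (hP : ∀ (y : g.Site) (v : F₂), b₃.loc y (P v) ≤ bN.loc y v)
    (h : Ineq190 bB bN dH C δ₀) : Ineq190 bB b₃ (P ∘ₗ dH) C δ₀ :=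
  hasMaj_postcomp_of_loc_le P hP h

end Transport

/-! ## §2. Compatibility of the sup presentation -/

section SupCompat

variable {g : B6.Geometry} {X : Type} {E : Type} [NormedAddCommGroup E] [NormedSpace ℝ E]
variable {box : g.Site → Finset X} {blk : X → g.Site}
variable {𝒴 : Type} [AddCommGroup 𝒴] [Module ℝ 𝒴]

/-- **Compatibility of the sup presentation with a size on `𝒴`**: if the `𝒴`-size of the block of `y` dominates the point values there
(`x ∈ box y → ‖ev x v‖ ≤ bN.loc y v` — print's (115)/(190) sizes are weighted sup norms over `x ∈ Δ(y)`), then the sup size of the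
presented lattice function is dominated by it. [cite: Balaban1985Variational, (190) p.308, (115) p.294] -/
theorem supSize_loc_pi_le {bN : BlockNorm g 𝒴} (ev : X → (𝒴 →ₗ[ℝ] E))
    (hev : ∀ (y : g.Site) (v : 𝒴), ∀ x ∈ box y, ‖ev x v‖ ≤ bN.loc y v) (y : g.Site) (v : 𝒴) :
    (supSize g box blk : BlockNorm g (X → E)).loc y (fun x => ev x v) ≤ bN.loc y v :=
  loc_le_of_forall (bN.loc_nonneg y v) (hev y v)

/-- The same for the linear presentation map `P = (x ↦ ev x)` written with `LinearMap.pi`. [cite: Balaban1985Variational, (190) p.308] -/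
theorem supSize_loc_pi_le' {bN : BlockNorm g 𝒴} (ev : X → (𝒴 →ₗ[ℝ] E))
    (hev : ∀ (y : g.Site) (v : 𝒴), ∀ x ∈ box y, ‖ev x v‖ ≤ bN.loc y v) (y : g.Site) (v : 𝒴) :
    (supSize g box blk : BlockNorm g (X → E)).loc y (LinearMap.pi ev v) ≤ bN.loc y v :=
  supSize_loc_pi_le ev hev y v

end SupCompat

/-! ## §3. Any ℂ-differentiable presentation: the hypotheses of `B11MeanValue190`, hence `hmv` -/

section Analytic

variable {𝒳 𝒴 : Type*} [NormedAddCommGroup 𝒳] [NormedSpace ℂ 𝒳] [NormedAddCommGroup 𝒴] [NormedSpace ℂ 𝒴]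

/-- Chain rule along the ray, evaluated: `Φ` has real Fréchet derivative `Φ'` at `t•B` ⇒ `τ ↦ ev (Φ (τ•B))` has derivative `ev (Φ' B)`
at `t`. [folklore] -/
private theorem hasDerivAt_eval_comp_smul {E : Type*} [NormedAddCommGroup E] [NormedSpace ℝ E] {Φ : 𝒳 → 𝒴}
    {Φ' : 𝒳 →L[ℝ] 𝒴} {B : 𝒳} {t : ℝ} (hΦ : HasFDerivAt Φ Φ' (t • B)) (ev : 𝒴 →L[ℝ] E) :
    HasDerivAt (fun τ : ℝ => ev (Φ (τ • B))) (ev (Φ' B)) t := by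
  have hline : HasDerivAt (fun τ : ℝ => τ • B) B t := by
    simpa using (hasDerivAt_id t).smul_const B
  exact ev.hasFDerivAt.comp_hasDerivAt t (hΦ.comp_hasDerivAt t hline)

variable {X : Type*} {E : Type*} [NormedAddCommGroup E] [NormedSpace ℝ E]

/-- **The two hypotheses of `B11MeanValue190` for ANY ℂ-differentiable presentation.**  `Φ : 𝒳 → 𝒴` with `Φ 0 = 0`, ℂ-differentiable
at every point `tB`, `t ∈ [0,1]`; a presentation `H B′ x = ev x (Φ B′)` through real CLMs; a derivative family with
`(dH t B)(x) = ev x (DΦ(tB)·B)` (`DΦ = fderiv ℂ Φ`): then `H 0 = 0` and `τ ↦ H(τB)(x)` has derivative `(dH τ B)(x)` within `[0,1]` at every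
`τ ∈ [0,1]`. [cite: Balaban1985Variational, Prop. 9 p.309, (175) p.305] -/
theorem presentation_hyps_of_differentiableAt {Φ : 𝒳 → 𝒴} {B : 𝒳} (h0 : Φ 0 = 0)
    (hΦ : ∀ t ∈ Icc (0:ℝ) 1, DifferentiableAt ℂ Φ (t • B)) (ev : X → (𝒴 →L[ℝ] E)) (H : 𝒳 → X → E)
    (dH : Icc (0:ℝ) 1 → 𝒳 →ₗ[ℝ] (X → E)) (hH : ∀ B' : 𝒳, H B' = fun x => ev x (Φ B'))
    (hdH : ∀ (t : Icc (0:ℝ) 1) (x : X), dH t B x = ev x (fderiv ℂ Φ ((t : ℝ) • B) B)) :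
    H 0 = 0 ∧ ∀ (x : X) (t : ℝ) (ht : t ∈ Icc (0:ℝ) 1),
      HasDerivWithinAt (fun τ : ℝ => H (τ • B) x) (dH ⟨t, ht⟩ B x) (Icc (0:ℝ) 1) t := by
  refine ⟨?_, fun x t ht => ?_⟩
  · rw [hH 0]
    funext x
    rw [h0, map_zero]
    rfl
  · rw [hdH ⟨t, ht⟩ x]
    have hF : HasFDerivAt Φ ((fderiv ℂ Φ (t • B)).restrictScalars ℝ) (t • B) :=
      (hΦ t ht).hasFDerivAt.restrictScalars ℝ
    have h := (hasDerivAt_eval_comp_smul hF (ev x)).hasDerivWithinAt (s := Icc (0:ℝ) 1)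
    refine h.congr (fun τ _ => ?_) ?_
    · rw [hH]
    · rw [hH]

end Analytic

section AnalyticSizes

variable {𝒳 𝒴 : Type*} [NormedAddCommGroup 𝒳] [NormedSpace ℂ 𝒳] [NormedAddCommGroup 𝒴] [NormedSpace ℂ 𝒴]

/-- **`hmv` at the sup size for any ℂ-differentiable presentation** (`bout := supSize g box blk`).
[cite: Balaban1985Variational, Prop. 9 (190) pp.308-309] -/
theorem hmv_supSize_of_differentiableAt {g : B6.Geometry} {X : Type} {E : Type} [NormedAddCommGroup E] [NormedSpace ℝ E]
    {box : g.Site → Finset X} {blk : X → g.Site} {Φ : 𝒳 → 𝒴} {B : 𝒳} (h0 : Φ 0 = 0)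
    (hΦ : ∀ t ∈ Icc (0:ℝ) 1, DifferentiableAt ℂ Φ (t • B)) (ev : X → (𝒴 →L[ℝ] E)) (H : 𝒳 → X → E)
    (dH : Icc (0:ℝ) 1 → 𝒳 →ₗ[ℝ] (X → E)) (hH : ∀ B' : 𝒳, H B' = fun x => ev x (Φ B'))
    (hdH : ∀ (t : Icc (0:ℝ) 1) (x : X), dH t B x = ev x (fderiv ℂ Φ ((t : ℝ) • B) B)) (y : g.Site) :
    ∀ s : ℝ, (∀ t, (supSize g box blk : BlockNorm g (X → E)).loc y (dH t B) ≤ s) →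
      (supSize g box blk : BlockNorm g (X → E)).loc y (H B) ≤ s := by
  obtain ⟨h0', hderiv⟩ := presentation_hyps_of_differentiableAt h0 hΦ ev H dH hH hdH
  exact hmv_supSize_of_forall H dH B y h0' hderiv

variable {d : ℕ} {𝔸 : Type} [NormedRing 𝔸] [NormedAlgebra ℂ 𝔸] {g : B6.Geometry}

/-- **`hmv` at the first-order size `covDerivBlockSize g y₀ S ξ U₀` for any ℂ-differentiable presentation** (`E := Fin d → 𝔸`).
[cite: Balaban1985Variational, Prop. 9 (190) pp.308-309] -/
theorem hmv_covDerivBlockSize_of_differentiableAt {Φ : 𝒳 → 𝒴} {B : 𝒳} (h0 : Φ 0 = 0)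
    (hΦ : ∀ t ∈ Icc (0:ℝ) 1, DifferentiableAt ℂ Φ (t • B)) (ev : B7Prop1Explicit.Site d → (𝒴 →L[ℝ] (Fin d → 𝔸)))
    (H : 𝒳 → B7Prop1Explicit.Site d → Fin d → 𝔸) (dH : Icc (0:ℝ) 1 → 𝒳 →ₗ[ℝ] (B7Prop1Explicit.Site d → Fin d → 𝔸))
    (hH : ∀ B' : 𝒳, H B' = fun x => ev x (Φ B'))
    (hdH : ∀ (t : Icc (0:ℝ) 1) (x : B7Prop1Explicit.Site d), dH t B x = ev x (fderiv ℂ Φ ((t : ℝ) • B) B))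
    {y₀ : g.Site} (y : g.Site) {S : g.Site → Finset (B7Prop1Explicit.Site d × Fin d × Fin d)} {ξ : ℝ}
    {U₀ : B7Prop1Explicit.Site d → Fin d → 𝔸ˣ} :
    ∀ s : ℝ, (∀ t, (covDerivBlockSize g y₀ S ξ U₀).loc y (dH t B) ≤ s) →
      (covDerivBlockSize g y₀ S ξ U₀).loc y (H B) ≤ s := by
  obtain ⟨h0', hderiv⟩ := presentation_hyps_of_differentiableAt h0 hΦ ev H dH hH hdH
  exact hmv_covDerivBlockSize H dH B y h0' hderiv

/-- **`hmv` at the weighted first-order size `ofSeminorms g y₀ (fun y => c • covDerivSize (S y) ξ U₀)`** (`hmv₁` of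
`B15From190LayerSizes.ineq148_of_ineq190_layer`) for any ℂ-differentiable presentation. [cite: Balaban1985Variational, Prop. 9 (190) pp.308-309] -/
theorem hmv_ofSeminorms_smul_covDerivSize_of_differentiableAt {Φ : 𝒳 → 𝒴} {B : 𝒳} (h0 : Φ 0 = 0)
    (hΦ : ∀ t ∈ Icc (0:ℝ) 1, DifferentiableAt ℂ Φ (t • B)) (ev : B7Prop1Explicit.Site d → (𝒴 →L[ℝ] (Fin d → 𝔸)))
    (H : 𝒳 → B7Prop1Explicit.Site d → Fin d → 𝔸) (dH : Icc (0:ℝ) 1 → 𝒳 →ₗ[ℝ] (B7Prop1Explicit.Site d → Fin d → 𝔸))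
    (hH : ∀ B' : 𝒳, H B' = fun x => ev x (Φ B'))
    (hdH : ∀ (t : Icc (0:ℝ) 1) (x : B7Prop1Explicit.Site d), dH t B x = ev x (fderiv ℂ Φ ((t : ℝ) • B) B))
    {y₀ : g.Site} (y : g.Site) {S : g.Site → Finset (B7Prop1Explicit.Site d × Fin d × Fin d)} {ξ : ℝ}
    {U₀ : B7Prop1Explicit.Site d → Fin d → 𝔸ˣ} (c : ℝ≥0) :
    ∀ s : ℝ, (∀ t, (ofSeminorms g y₀ (fun y => c • covDerivSize (S y) ξ U₀)).loc y (dH t B) ≤ s) →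
      (ofSeminorms g y₀ (fun y => c • covDerivSize (S y) ξ U₀)).loc y (H B) ≤ s := by
  obtain ⟨h0', hderiv⟩ := presentation_hyps_of_differentiableAt h0 hΦ ev H dH hH hdH
  exact hmv_ofSeminorms_smul_covDerivSize H dH B y c h0' hderiv

end AnalyticSizes

/-! ## §4. The (179)–(180) representation: `B11Eq183Differentiation.chartH179` -/

section Chart179

variable {𝒳 𝒴 𝒵 : Type*} [NormedAddCommGroup 𝒳] [NormedSpace ℂ 𝒳] [NormedAddCommGroup 𝒴] [NormedSpace ℂ 𝒴]
  [NormedAddCommGroup 𝒵] [NormedSpace ℂ 𝒵]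
variable {𝒢 : 𝒵 →L[ℂ] 𝒴} {W : 𝒴 → 𝒵} {D2 : 𝒴 →L[ℂ] 𝒵} {H₀ : 𝒳 →L[ℂ] 𝒴} {Tm : 𝒴 → 𝒴} {B₀ θ C₄ a₃ j a ε₄ : ℝ}

/-- The segment stays in the domain of (180): `‖H₀(tB)‖ = t‖H₀B‖`, `‖Δ⁽²⁾H₀(tB)‖ = t‖Δ⁽²⁾H₀B‖`, `t ∈ [0,1]`.
[cite: Balaban1985Variational, (180) p.306] -/
theorem dom180_smul {B : 𝒳} (hB : ‖H₀ B‖ < a ∧ ‖D2 (H₀ B)‖ < j) {t : ℝ} (ht : t ∈ Icc (0:ℝ) 1) :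
    ‖H₀ (t • B)‖ < a ∧ ‖D2 (H₀ (t • B))‖ < j := by
  rw [H₀.map_smul_of_tower, D2.map_smul_of_tower, norm_smul, norm_smul, Real.norm_eq_abs, abs_of_nonneg ht.1]
  exact ⟨(mul_le_of_le_one_left (norm_nonneg _) ht.2).trans_lt hB.1,
    (mul_le_of_le_one_left (norm_nonneg _) ht.2).trans_lt hB.2⟩

variable [CompleteSpace 𝒴]

/-- **`𝓗(0) = 0` in the representation (179)** (`Tm 0 = 0`; (180) at `B = 0` has source `−Δ⁽²⁾H₀0 = 0` and shift `H₀0 = 0`, hence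
the solution `𝒜₀ = 0`). [cite: Balaban1985Variational, (179)–(180) p.306, Prop. 9 p.309] -/
theorem chartH179_zero (R : Regime 𝒢 0 W B₀ θ C₄ a₃ j a ε₄) (hj : 0 ≤ j) (ha : 0 < a) (hTm0 : Tm 0 = 0) :
    chartH179 𝒢 W D2 H₀ Tm ε₄ (0 : 𝒳) = 0 := by
  rw [chartH179, map_zero, map_zero, neg_zero]
  exact R.chartH_zero hj ha hTm0

variable [CompleteSpace 𝒳] [CompleteSpace 𝒵]

/-- **ℂ-differentiability of the (179) chart at the points of the segment** (r08's `analyticOnNhd_chartH179`: «𝓗(B) is an analytic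
function of … B»). [cite: Balaban1985Variational, p.306, Prop. 9 p.309] -/
theorem differentiableAt_chartH179_smul (R : Regime 𝒢 0 W B₀ θ C₄ a₃ j a ε₄)
    (hWa : AnalyticOnNhd ℂ W {Y : 𝒴 | ‖Y‖ < a₃}) (hTm : AnalyticOnNhd ℂ Tm {Y : 𝒴 | ‖Y‖ < ε₄ + a})
    {B : 𝒳} (hB : ‖H₀ B‖ < a ∧ ‖D2 (H₀ B)‖ < j) {t : ℝ} (ht : t ∈ Icc (0:ℝ) 1) :
    DifferentiableAt ℂ (chartH179 𝒢 W D2 H₀ Tm ε₄) (t • B) :=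
  ((analyticOnNhd_chartH179 R hWa hTm) (t • B) (dom180_smul hB ht)).differentiableAt

section Sizes179

variable {X : Type} {E : Type} [NormedAddCommGroup E] [NormedSpace ℝ E] {g : B6.Geometry}
variable {box : g.Site → Finset X} {blk : X → g.Site}

/-- **`hmv` FOR THE (179) CHART, VALUES** (`bout := supSize g box blk`): for any presentation `H B′ x = ev x (𝓗(B′))` and any derivative
family with `(dH t B)(x) = ev x (D𝓗(tB)·B)` — regime, analyticity letters, `Tm 0 = 0`, domain condition, nothing else.
[cite: Balaban1985Variational, Prop. 9 (190) pp.308-309, (179)-(180) p.306] -/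
theorem hmv_supSize_chartH179 (R : Regime 𝒢 0 W B₀ θ C₄ a₃ j a ε₄)
    (hWa : AnalyticOnNhd ℂ W {Y : 𝒴 | ‖Y‖ < a₃}) (hTm : AnalyticOnNhd ℂ Tm {Y : 𝒴 | ‖Y‖ < ε₄ + a}) (hTm0 : Tm 0 = 0)
    (ev : X → (𝒴 →L[ℝ] E)) (H : 𝒳 → X → E) (dH : Icc (0:ℝ) 1 → 𝒳 →ₗ[ℝ] (X → E)) {B : 𝒳}
    (hB : ‖H₀ B‖ < a ∧ ‖D2 (H₀ B)‖ < j) (hH : ∀ B' : 𝒳, H B' = fun x => ev x (chartH179 𝒢 W D2 H₀ Tm ε₄ B'))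
    (hdH : ∀ (t : Icc (0:ℝ) 1) (x : X), dH t B x = ev x (fderiv ℂ (chartH179 𝒢 W D2 H₀ Tm ε₄) ((t : ℝ) • B) B))
    (y : g.Site) :
    ∀ s : ℝ, (∀ t, (supSize g box blk : BlockNorm g (X → E)).loc y (dH t B) ≤ s) →
      (supSize g box blk : BlockNorm g (X → E)).loc y (H B) ≤ s :=
  hmv_supSize_of_differentiableAt
    (chartH179_zero R (le_of_lt ((norm_nonneg _).trans_lt hB.2)) ((norm_nonneg _).trans_lt hB.1) hTm0)
    (fun _ ht => differentiableAt_chartH179_smul R hWa hTm hB ht) ev H dH hH hdH y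

variable {d : ℕ} {𝔸 : Type} [NormedRing 𝔸] [NormedAlgebra ℂ 𝔸]

/-- **`hmv` FOR THE (179) CHART, FIRST-ORDER SIZE** `covDerivBlockSize g y₀ S ξ U₀`. [cite: Balaban1985Variational, Prop. 9 (190) pp.308-309, (179)-(180) p.306] -/
theorem hmv_covDerivBlockSize_chartH179 (R : Regime 𝒢 0 W B₀ θ C₄ a₃ j a ε₄)
    (hWa : AnalyticOnNhd ℂ W {Y : 𝒴 | ‖Y‖ < a₃}) (hTm : AnalyticOnNhd ℂ Tm {Y : 𝒴 | ‖Y‖ < ε₄ + a}) (hTm0 : Tm 0 = 0)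
    (ev : B7Prop1Explicit.Site d → (𝒴 →L[ℝ] (Fin d → 𝔸))) (H : 𝒳 → B7Prop1Explicit.Site d → Fin d → 𝔸)
    (dH : Icc (0:ℝ) 1 → 𝒳 →ₗ[ℝ] (B7Prop1Explicit.Site d → Fin d → 𝔸)) {B : 𝒳} (hB : ‖H₀ B‖ < a ∧ ‖D2 (H₀ B)‖ < j)
    (hH : ∀ B' : 𝒳, H B' = fun x => ev x (chartH179 𝒢 W D2 H₀ Tm ε₄ B'))
    (hdH : ∀ (t : Icc (0:ℝ) 1) (x : B7Prop1Explicit.Site d),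
      dH t B x = ev x (fderiv ℂ (chartH179 𝒢 W D2 H₀ Tm ε₄) ((t : ℝ) • B) B))
    {y₀ : g.Site} (y : g.Site) {S : g.Site → Finset (B7Prop1Explicit.Site d × Fin d × Fin d)} {ξ : ℝ}
    {U₀ : B7Prop1Explicit.Site d → Fin d → 𝔸ˣ} :
    ∀ s : ℝ, (∀ t, (covDerivBlockSize g y₀ S ξ U₀).loc y (dH t B) ≤ s) →
      (covDerivBlockSize g y₀ S ξ U₀).loc y (H B) ≤ s :=
  hmv_covDerivBlockSize_of_differentiableAt
    (chartH179_zero R (le_of_lt ((norm_nonneg _).trans_lt hB.2)) ((norm_nonneg _).trans_lt hB.1) hTm0)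
    (fun _ ht => differentiableAt_chartH179_smul R hWa hTm hB ht) ev H dH hH hdH y

/-- **`hmv` FOR THE (179) CHART, WEIGHTED FIRST-ORDER SIZE** (`hmv₁` of `B15From190LayerSizes.ineq148_of_ineq190_layer`).
[cite: Balaban1985Variational, Prop. 9 (190) pp.308-309, (179)-(180) p.306] -/
theorem hmv_ofSeminorms_smul_covDerivSize_chartH179 (R : Regime 𝒢 0 W B₀ θ C₄ a₃ j a ε₄)
    (hWa : AnalyticOnNhd ℂ W {Y : 𝒴 | ‖Y‖ < a₃}) (hTm : AnalyticOnNhd ℂ Tm {Y : 𝒴 | ‖Y‖ < ε₄ + a}) (hTm0 : Tm 0 = 0)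
    (ev : B7Prop1Explicit.Site d → (𝒴 →L[ℝ] (Fin d → 𝔸))) (H : 𝒳 → B7Prop1Explicit.Site d → Fin d → 𝔸)
    (dH : Icc (0:ℝ) 1 → 𝒳 →ₗ[ℝ] (B7Prop1Explicit.Site d → Fin d → 𝔸)) {B : 𝒳} (hB : ‖H₀ B‖ < a ∧ ‖D2 (H₀ B)‖ < j)
    (hH : ∀ B' : 𝒳, H B' = fun x => ev x (chartH179 𝒢 W D2 H₀ Tm ε₄ B'))
    (hdH : ∀ (t : Icc (0:ℝ) 1) (x : B7Prop1Explicit.Site d),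
      dH t B x = ev x (fderiv ℂ (chartH179 𝒢 W D2 H₀ Tm ε₄) ((t : ℝ) • B) B))
    {y₀ : g.Site} (y : g.Site) {S : g.Site → Finset (B7Prop1Explicit.Site d × Fin d × Fin d)} {ξ : ℝ}
    {U₀ : B7Prop1Explicit.Site d → Fin d → 𝔸ˣ} (c : ℝ≥0) :
    ∀ s : ℝ, (∀ t, (ofSeminorms g y₀ (fun y => c • covDerivSize (S y) ξ U₀)).loc y (dH t B) ≤ s) →
      (ofSeminorms g y₀ (fun y => c • covDerivSize (S y) ξ U₀)).loc y (H B) ≤ s :=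
  hmv_ofSeminorms_smul_covDerivSize_of_differentiableAt
    (chartH179_zero R (le_of_lt ((norm_nonneg _).trans_lt hB.2)) ((norm_nonneg _).trans_lt hB.1) hTm0)
    (fun _ ht => differentiableAt_chartH179_smul R hWa hTm hB ht) ev H dH hH hdH y c

end Sizes179

end Chart179

/-! ## §5. END TO END: the consumers' pair (`h190`, `hmv`) from (190) on the configuration space -/

section EndToEnd

variable {𝒳 𝒴 𝒵 : Type} [NormedAddCommGroup 𝒳] [NormedSpace ℂ 𝒳] [NormedAddCommGroup 𝒴] [NormedSpace ℂ 𝒴]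
  [NormedAddCommGroup 𝒵] [NormedSpace ℂ 𝒵] [CompleteSpace 𝒳] [CompleteSpace 𝒴] [CompleteSpace 𝒵]
variable {𝒢 : 𝒵 →L[ℂ] 𝒴} {W : 𝒴 → 𝒵} {D2 : 𝒴 →L[ℂ] 𝒵} {H₀ : 𝒳 →L[ℂ] 𝒴} {Tm : 𝒴 → 𝒴} {B₀ θ C₄ a₃ j a ε₄ : ℝ}
variable {g : B6.Geometry} {F₃ : Type} [AddCommGroup F₃] [Module ℝ F₃]

omit [CompleteSpace 𝒳] [CompleteSpace 𝒴] [CompleteSpace 𝒵] in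
/-- **The `h190` half for ANY compatible output size** on the presented space: (190) ON `𝒴` for the actual derivatives `D𝓗(B′)` at the
points `B′` of the domain of (180) (the B11 block's output shape, `B11SectG.ineq190_of_189` with `B11Eq183Differentiation`) and a
presentation `P : 𝒴 →ₗ[ℝ] F₃` that does not increase sizes (`b₃.loc y (P v) ≤ bN.loc y v`) give `Ineq190 bB b₃ (dH t) C δ₀` for
`dH t = P ∘ D𝓗(tB)` at EVERY `t ∈ [0,1]`. [cite: Balaban1985Variational, Prop. 9 (190) pp.308-309] -/
theorem ineq190_presentation_chartH179 {B : 𝒳} (hB : ‖H₀ B‖ < a ∧ ‖D2 (H₀ B)‖ < j) {bB : BlockNorm g 𝒳} {bN : BlockNorm g 𝒴}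
    {b₃ : BlockNorm g F₃} {C δ₀ : ℝ} (P : 𝒴 →ₗ[ℝ] F₃) (hP : ∀ (y : g.Site) (v : 𝒴), b₃.loc y (P v) ≤ bN.loc y v)
    (h190Y : ∀ B' : 𝒳, ‖H₀ B'‖ < a → ‖D2 (H₀ B')‖ < j →
      Ineq190 bB bN ((fderiv ℂ (chartH179 𝒢 W D2 H₀ Tm ε₄) B').restrictScalars ℝ : 𝒳 →ₗ[ℝ] 𝒴) C δ₀)
    (dH : Icc (0:ℝ) 1 → 𝒳 →ₗ[ℝ] F₃)
    (hdH : ∀ t : Icc (0:ℝ) 1, dH t =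
      P ∘ₗ ((fderiv ℂ (chartH179 𝒢 W D2 H₀ Tm ε₄) ((t : ℝ) • B)).restrictScalars ℝ : 𝒳 →ₗ[ℝ] 𝒴)) :
    ∀ t : Icc (0:ℝ) 1, Ineq190 bB b₃ (dH t) C δ₀ := by
  intro t
  rw [hdH t]
  have hdom := dom180_smul hB t.2
  exact ineq190_postcomp_of_loc_le P hP (h190Y _ hdom.1 hdom.2)

variable {X : Type} {E : Type} [NormedAddCommGroup E] [NormedSpace ℝ E] {box : g.Site → Finset X} {blk : X → g.Site}

/-- **END TO END FOR THE SUP SIZE** — the consumers' PAIR of located hypotheses, for the presented (179) chart `H B′ x = ev x (𝓗(B′))`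
with the canonical derivative family `dH t = (x ↦ ev x) ∘ D𝓗(tB)`: from the regime (117)–(121), the analyticity letters of Prop. 4 /
Sect. C, `Tm 0 = 0`, the domain condition on `B`, the compatibility letter `x ∈ box y → ‖ev x v‖ ≤ bN.loc y v`, and (190) ON `𝒴` for
`D𝓗(B′)` at the points of the domain: `(∀ t, Ineq190 bB (supSize g box blk) (dH t) C δ₀)` AND
`∀ s, (∀ t, loc y (dH t B) ≤ s) → loc y (H B) ≤ s` — exactly the `h190`, `hmv` of `B15HDecayLeaves.loc_le_of_meanValue`,
`B15From190LayerSizes.*`, `B14From190SupSize.*`. [cite: Balaban1985Variational, Prop. 9 (190) pp.308-309, (179)-(180) p.306] -/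
theorem ineq190_and_hmv_supSize_chartH179 (R : Regime 𝒢 0 W B₀ θ C₄ a₃ j a ε₄)
    (hWa : AnalyticOnNhd ℂ W {Y : 𝒴 | ‖Y‖ < a₃}) (hTm : AnalyticOnNhd ℂ Tm {Y : 𝒴 | ‖Y‖ < ε₄ + a}) (hTm0 : Tm 0 = 0)
    {B : 𝒳} (hB : ‖H₀ B‖ < a ∧ ‖D2 (H₀ B)‖ < j) (ev : X → (𝒴 →L[ℝ] E)) {bB : BlockNorm g 𝒳} {bN : BlockNorm g 𝒴}
    {C δ₀ : ℝ} (hev : ∀ (y : g.Site) (v : 𝒴), ∀ x ∈ box y, ‖ev x v‖ ≤ bN.loc y v)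
    (h190Y : ∀ B' : 𝒳, ‖H₀ B'‖ < a → ‖D2 (H₀ B')‖ < j →
      Ineq190 bB bN ((fderiv ℂ (chartH179 𝒢 W D2 H₀ Tm ε₄) B').restrictScalars ℝ : 𝒳 →ₗ[ℝ] 𝒴) C δ₀)
    (H : 𝒳 → X → E) (dH : Icc (0:ℝ) 1 → 𝒳 →ₗ[ℝ] (X → E))
    (hH : ∀ B' : 𝒳, H B' = fun x => ev x (chartH179 𝒢 W D2 H₀ Tm ε₄ B'))
    (hdH : ∀ t : Icc (0:ℝ) 1, dH t = (LinearMap.pi fun x => ((ev x : 𝒴 →L[ℝ] E) : 𝒴 →ₗ[ℝ] E)) ∘ₗ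
      ((fderiv ℂ (chartH179 𝒢 W D2 H₀ Tm ε₄) ((t : ℝ) • B)).restrictScalars ℝ : 𝒳 →ₗ[ℝ] 𝒴))
    (y : g.Site) :
    (∀ t : Icc (0:ℝ) 1, Ineq190 bB (supSize g box blk : BlockNorm g (X → E)) (dH t) C δ₀) ∧
      ∀ s : ℝ, (∀ t, (supSize g box blk : BlockNorm g (X → E)).loc y (dH t B) ≤ s) →
        (supSize g box blk : BlockNorm g (X → E)).loc y (H B) ≤ s := by
  refine ⟨ineq190_presentation_chartH179 hB (LinearMap.pi fun x => ((ev x : 𝒴 →L[ℝ] E) : 𝒴 →ₗ[ℝ] E))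
      (fun y' v => supSize_loc_pi_le' (fun x => ((ev x : 𝒴 →L[ℝ] E) : 𝒴 →ₗ[ℝ] E)) hev y' v) h190Y dH hdH, ?_⟩
  refine hmv_supSize_chartH179 R hWa hTm hTm0 ev H dH hB hH (fun t x => ?_) y
  rw [hdH t]
  rfl

end EndToEnd

end Literature.MathematicalPhysics.QuantumFieldTheory.Balaban1983to89.B11Presentation190
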